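import Literature.MathematicalPhysics.QuantumLattice.Imbrie2016.LLA

/-!
# Imbrie (2016), Assumption LLA: the random fields and bonds move H along local diagonal directions

CITATION HEADER (lean-in-tree rule 2026-08-18). J. Z. Imbrie, *On many-body localization for quantum spin chains*,
J. Stat. Phys. **163** (2016) 998–1048, doi 10.1007/s10955-016-1508-x, arXiv:1403.7837 [ImbrieJSP2016], eq. (1.1) (the Hamiltonian
of the n-site box: fields h_i S^z_i, bonds J_i S^z_{i-1} S^z_i with + boundary spins, transverse terms γ Γ_i S^x_i), eq. (1.3) (LLA).

WHAT IS PROVED (a lemma of the audit cell `pub-imbrie`, NOT a statement of the paper; the dictionary behind pub-imbrie LLA.md gen-4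
block G / V15).  The level-velocity reformulation of LLA differentiates the eigenvalues of the tree's matrix `H γ p` (file `LLA`) in the
directions of the individual random couplings.  These lemmas record, at the matrix level and with no analysis, that those directions are
LOCAL DIAGONAL operators: adding `c` to the field `h i` adds `c · diag(szZ σ i)` (= c S^z_i) to `H γ p` (`H_add_field`), adding `c` to the
bond `J b` adds `c · diag(szZ σ (b-1) · szZ σ b)` (= c S^z_{b-1} S^z_b, a single boundary spin S^z for b = 0 or b = n) (`H_add_bond`), and the
transverse factors Γ enter only the off-diagonal part (`diagEnergy` ignores them, `offDiag` ignores h and J: `offDiag_eq_of_Γ_eq`).  Hence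
"∂_V" in LLA.md G3/G4′ and the sign functions `s_V(σ)` of `TwoSiteSpread` / `ThreeSiteSpread` are exactly `szZ σ i` and
`szZ σ (b-1) szZ σ b` of eq. (1.1).

STATUS: definitional bookkeeping; says NOTHING about whether LLA holds (OPEN, pub-imbrie LLA.md §7). No `sorry`, no new axioms, no new definitions.
-/

namespace Literature.MathematicalPhysics.QuantumLattice.Imbrie2016

open Finset

variable {n : ℕ}

/-- adding `c` to the field at site `i` adds `c · szZ σ i` to every diagonal energy. [cite: ImbrieJSP2016, eq. (1.1)] -/
theorem diagEnergy_add_field (p : Params n) (i : Fin n) (c : ℝ) (σ : Cfg n) :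
    diagEnergy { p with h := fun j => p.h j + if j = i then c else 0 } σ = diagEnergy p σ + c * szZ σ i := by
  unfold diagEnergy
  simp only [add_mul, ite_mul, zero_mul, Finset.sum_add_distrib, Finset.sum_ite_eq', Finset.mem_univ, if_true]
  ring

/-- adding `c` to the bond `J b` adds `c · szZ σ (b-1) · szZ σ b` to every diagonal energy (for `b = 0` resp. `b = n` one factor is the
+ boundary spin, `szZ = 1` outside the box). [cite: ImbrieJSP2016, eq. (1.1)] -/
theorem diagEnergy_add_bond (p : Params n) (b : Fin (n + 1)) (c : ℝ) (σ : Cfg n) :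
    diagEnergy { p with J := fun j => p.J j + if j = b then c else 0 } σ
      = diagEnergy p σ + c * (szZ σ ((b : ℤ) - 1) * szZ σ b) := by
  unfold diagEnergy
  simp only [add_mul, ite_mul, zero_mul, Finset.sum_add_distrib, Finset.sum_ite_eq', Finset.mem_univ, if_true]
  ring

/-- the off-diagonal (transverse) part depends on the couplings only through Γ. [cite: ImbrieJSP2016, eq. (1.1)] -/
theorem offDiag_eq_of_Γ_eq (γ : ℝ) (p q : Params n) (hΓ : p.Γ = q.Γ) : offDiag γ p = offDiag γ q := by
  funext σ τ
  simp only [offDiag, hΓ]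

/-- the field `h i` moves `H` along the local diagonal operator S^z_i:
`H(h + c e_i) = H(h) + c · diag(σ ↦ szZ σ i)`. [cite: ImbrieJSP2016, eq. (1.1), (1.3)] -/
theorem H_add_field (γ : ℝ) (p : Params n) (i : Fin n) (c : ℝ) :
    H γ { p with h := fun j => p.h j + if j = i then c else 0 }
      = H γ p + Matrix.diagonal (fun σ => c * szZ σ i) := by
  have hd : diagEnergy { p with h := fun j => p.h j + if j = i then c else 0 }
      = fun σ => diagEnergy p σ + c * szZ σ i := by
    funext σ; rw [diagEnergy_add_field]
  have ho : offDiag γ { p with h := fun j => p.h j + if j = i then c else 0 } = offDiag γ p :=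
    offDiag_eq_of_Γ_eq γ _ _ rfl
  unfold H
  rw [hd, ho, ← Matrix.diagonal_add]
  abel

/-- the bond `J b` moves `H` along the local diagonal operator S^z_{b-1} S^z_b (a single boundary-adjacent S^z for `b = 0`, `b = n`):
`H(J + c e_b) = H(J) + c · diag(σ ↦ szZ σ (b-1) szZ σ b)`. [cite: ImbrieJSP2016, eq. (1.1), (1.3)] -/
theorem H_add_bond (γ : ℝ) (p : Params n) (b : Fin (n + 1)) (c : ℝ) :
    H γ { p with J := fun j => p.J j + if j = b then c else 0 }
      = H γ p + Matrix.diagonal (fun σ => c * (szZ σ ((b : ℤ) - 1) * szZ σ b)) := by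
  have hd : diagEnergy { p with J := fun j => p.J j + if j = b then c else 0 }
      = fun σ => diagEnergy p σ + c * (szZ σ ((b : ℤ) - 1) * szZ σ b) := by
    funext σ; rw [diagEnergy_add_bond]
  have ho : offDiag γ { p with J := fun j => p.J j + if j = b then c else 0 } = offDiag γ p :=
    offDiag_eq_of_Γ_eq γ _ _ rfl
  unfold H
  rw [hd, ho, ← Matrix.diagonal_add]
  abel

/-- the boundary bonds act as fields: for `b = 0` the direction of `J 0` is `diag(szZ σ 0)` (left boundary spin is +1).
[cite: ImbrieJSP2016, eq. (1.1)] -/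
theorem szZ_neg_one (σ : Cfg n) : szZ σ (-1) = 1 := by
  simp [szZ]

/-- … and for `b = n` the direction of `J n` is `diag(szZ σ (n-1))` (right boundary spin is +1). [cite: ImbrieJSP2016, eq. (1.1)] -/
theorem szZ_n (σ : Cfg n) : szZ σ (n : ℤ) = 1 := by
  simp [szZ]

end Literature.MathematicalPhysics.QuantumLattice.Imbrie2016
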